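import Summits.ResolutionOfSingularities.ResolutionOfSingularities.Theorems.PurelyInseparableDim4LoopCRegion
import HarnessLib

/-!
# LOOP-E ‖ K: crit-1's LONE-PLANE hop 4-cycle at `(p,q) = (3,3)` and its THREE-VARIABLE variant — regions
# closed for B in the GLOBAL game `Edge` against THE (unique) `3`-fold coordinate component, every state IN
# COORDINATE SCOPE (cell `res-dim4-pi`, seat res-dim4-p-8 g2; specimen of res-dim4-crit-1 V-A-30 (G); desk
# WORDS #54 (b) / #55 (b): LOCATED, K = crit-1 ∧ eng-w4 g2 j316916 (edges + Singular scope) ∧ this file)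

[OURS · counted 0 · kernel certificate of a located specimen; statements about OUR coordinate-centre frame
(`PIDim4.Edge`, `PIDim4.InCoordinateScope`, `ComponentThreads.IsComponent`) only; NOT about the local game
`EdgeLoc`, NOT about `TerminatesInScope 3 3` in its ∃-rule form, and nothing here proves or refutes resolution of
singularities in dimension `≥ 4` / characteristic `p`.]

crit-1 (V-A-30 on CARD I-2-7): with `u = 1 + x₃`, `v = 1 + x₄` over `𝔽₃`,
`t1 = x₁²x₄²u²(u²(1+x₂) + x₄²)` —`V(x₁,x₄)`, `x₁`-chart, origin→ `t2 = x₁x₄²u²(u²(1+x₂) + x₁²x₄²)` —`x₁`-chart, HOP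
`b = (0,0,2,1)`→ `t3 = x₃²v²(x₃²(1+x₂) + x₁⁴v²)` —`V(x₁,x₃)`, `x₁`-chart, origin→ `t4 = x₁x₃²v²(x₃²(1+x₂) + x₁²v²)`
—HOP `b = (0,0,1,2)`→ `t1`; at every state the coordinate `3`-fold locus has EXACTLY ONE component (the plane
blown up), so the cycle defeats, in the global game, every rule keyed to the component structure that blows up
the lone component when there is one (`R_X`, `R_XT`, `R_OD`, cardinality-first, …).  Re-derived by this seat's
independent implementation (`HOME/res-dim4-p-8/g2/loope.py`: polynomials expanded from the formulas, unique
component at each state, the four edges equimultiple with the stated children — EXACT; `(r, exc)` decorations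
close after 5 rows: `r₁` = exceptional multiplicity of `x₁` runs `0, 1, 0, 1, 2, 1, 0, 1, 2, …`).

Contents: §1–§2 LOOP-E: data `eL0 … eL3`, `e0 … e4`, `eR`, `eW0 … eW3`; kernel checks `regionB_e`,
`scope_eL0 … scope_eL3` (`LoopC.regionB` / `LoopC.scopeCertB` of `…LoopCRegion`, `decide +kernel`); conclusions
**`e_region`**, **`e_inScope`**, `e0_mem`, **`e_lone`** (exactly one component at every state, kernel-checked) and
the rule-level negative **`exists_inScope_branch_of_loneComponentRule`**.  §3–§4 **LOOP-E′ — THE SAME IN THREE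
VARIABLES**: crit-1's `x₂`-free variant `t1′ = x₁²x₄²u²(u² + x₄²)` cycles with period 4 under the identical hop
pattern (eng-w4 g2: `t1′-cyc-0…3`; here `gL0 … gL3`, `gR`, `g_region`, `g_inScope`, `g_lone`,
`exists_inScope_branch_of_loneComponentRule'`) — lone-plane component hopping is already a THREE-VARIABLE
(`(3,1)`-shaped) phenomenon (Δ(4 vs 3) board: no fourth variable needed for this specimen class).
bears_on: LADDER-RESOLUTION:D157-DOOR2 (res-dim4-pi · F4-C-glob(3,3) · LOOP-E ‖ K · I-2-7 DEAD · Δ(4 vs 3)).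
Supports stmt-ResolutionOfSingularities-16155 (helper).
-/

set_option linter.dupNamespace false -- mandated namespace of this single-conjunct summit

noncomputable section

open MvPolynomial Finset
open scoped BigOperators

namespace Summit.ResolutionOfSingularities.ResolutionOfSingularities.Theorems.PIDim4

namespace LoopC

open StepKit ScopeCover ComponentThreads
open Literature.AlgebraicGeometry.Resolution
open Literature.AlgebraicGeometry.Resolution.CentreBlowup

/-! ## §1 LOOP-E data (over `𝔽₃`) -/

/-- LOOP-E: polynomial `eL0` (crit-1's `t1`). [OURS · specimen] -/
def eL0 : Terms 4 (ZMod 3) := [(![2, 0, 0, 2], 1), (![2, 0, 1, 2], 1), (![2, 1, 0, 2], 1), (![2, 0, 0, 4], 1), (![2, 1, 1, 2], 1), (![2, 0, 1, 4], 2), (![2, 0, 3, 2], 1), (![2, 0, 2, 4], 1), (![2, 0, 4, 2], 1), (![2, 1, 3, 2], 1), (![2, 1, 4, 2], 1)]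

/-- LOOP-E: polynomial `eL1` (crit-1's `t2`). [OURS · specimen] -/
def eL1 : Terms 4 (ZMod 3) := [(![1, 0, 0, 2], 1), (![1, 0, 1, 2], 1), (![1, 1, 0, 2], 1), (![1, 1, 1, 2], 1), (![1, 0, 3, 2], 1), (![1, 0, 4, 2], 1), (![1, 1, 3, 2], 1), (![3, 0, 0, 4], 1), (![1, 1, 4, 2], 1), (![3, 0, 1, 4], 2), (![3, 0, 2, 4], 1)]

/-- LOOP-E: polynomial `eL2` (crit-1's `t3`). [OURS · specimen] -/
def eL2 : Terms 4 (ZMod 3) := [(![0, 0, 4, 0], 1), (![0, 0, 4, 1], 2), (![0, 1, 4, 0], 1), (![0, 0, 4, 2], 1), (![0, 1, 4, 1], 2), (![4, 0, 2, 0], 1), (![0, 1, 4, 2], 1), (![4, 0, 2, 1], 1), (![4, 0, 2, 3], 1), (![4, 0, 2, 4], 1)]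

/-- LOOP-E: polynomial `eL3` (crit-1's `t4`). [OURS · specimen] -/
def eL3 : Terms 4 (ZMod 3) := [(![1, 0, 4, 0], 1), (![3, 0, 2, 0], 1), (![1, 0, 4, 1], 2), (![1, 1, 4, 0], 1), (![3, 0, 2, 1], 1), (![1, 0, 4, 2], 1), (![1, 1, 4, 1], 2), (![1, 1, 4, 2], 1), (![3, 0, 2, 3], 1), (![3, 0, 2, 4], 1)]

/-- LOOP-E: region state `e0` = (`eL0`, `r = [0, 0, 0, 0]`, `exc = ∅`). [OURS · specimen] -/
def e0 : SData 4 (ZMod 3) := ⟨eL0, ![0, 0, 0, 0], ∅⟩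

/-- LOOP-E: region state `e1` = (`eL1`, `r = [1, 0, 0, 0]`, `exc = {0}`). [OURS · specimen] -/
def e1 : SData 4 (ZMod 3) := ⟨eL1, ![1, 0, 0, 0], {0}⟩

/-- LOOP-E: region state `e2` = (`eL2`, `r = [0, 0, 0, 0]`, `exc = {0}`). [OURS · specimen] -/
def e2 : SData 4 (ZMod 3) := ⟨eL2, ![0, 0, 0, 0], {0}⟩

/-- LOOP-E: region state `e3` = (`eL3`, `r = [1, 0, 0, 0]`, `exc = {0}`). [OURS · specimen] -/
def e3 : SData 4 (ZMod 3) := ⟨eL3, ![1, 0, 0, 0], {0}⟩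

/-- LOOP-E: region state `e4` = (`eL0`, `r = [2, 0, 0, 0]`, `exc = {0}`). [OURS · specimen] -/
def e4 : SData 4 (ZMod 3) := ⟨eL0, ![2, 0, 0, 0], {0}⟩

/-- LOOP-E region table: crit-1 V-A-30 (G) LOOP-E (`t1 = x₁²x₄²u²(u²(1+x₂) + x₄²)`, `u = 1 + x₃`, `v = 1 + x₄`; lone-plane hop 4-cycle); rows = (state, B's reply `(centre, chart, point, child row)` to the LONE
maximal-dimensional component). [OURS · specimen] -/
def eR : TrapRows (ZMod 3) :=
  [(e0, [({0, 3}, 0, ![0, 0, 0, 0], 1)]),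
   (e1, [({0, 3}, 0, ![0, 0, 2, 1], 2)]),
   (e2, [({0, 2}, 0, ![0, 0, 0, 0], 3)]),
   (e3, [({0, 2}, 0, ![0, 0, 1, 2], 4)]),
   (e4, [({0, 3}, 0, ![0, 0, 0, 0], 1)])]

/-- LOOP-E: in-scope witnesses `(α, m)` for `eL0`. [OURS · certificate data] -/
def eW0 : List ((Fin 4 → ℕ) × (Fin 4 → ℕ)) := [(![0, 0, 0, 2], ![2, 0, 0, 0]), (![2, 0, 0, 0], ![0, 0, 0, 2])]

/-- LOOP-E: in-scope witnesses `(α, m)` for `eL1`. [OURS · certificate data] -/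
def eW1 : List ((Fin 4 → ℕ) × (Fin 4 → ℕ)) := [(![0, 0, 0, 2], ![1, 0, 0, 0]), (![1, 0, 0, 0], ![0, 0, 0, 2])]

/-- LOOP-E: in-scope witnesses `(α, m)` for `eL2`. [OURS · certificate data] -/
def eW2 : List ((Fin 4 → ℕ) × (Fin 4 → ℕ)) := [(![0, 0, 0, 2], ![0, 0, 4, 0]), (![0, 0, 2, 0], ![4, 0, 0, 0])]

/-- LOOP-E: in-scope witnesses `(α, m)` for `eL3`. [OURS · certificate data] -/
def eW3 : List ((Fin 4 → ℕ) × (Fin 4 → ℕ)) := [(![0, 0, 2, 0], ![3, 0, 0, 0]), (![1, 0, 0, 0], ![0, 0, 4, 0])]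

/-! ## §2 LOOP-E: kernel checks and conclusions -/

/-- LOOP-E: the region table checks (`LoopC.regionB`). [OURS · ‖ K] -/
theorem regionB_e : regionB 3 eR = true := by decide +kernel

/-- LOOP-E: `eL0` is in coordinate scope (`LoopC.scopeCertB`). [OURS · ‖ K] -/
theorem scope_eL0 : scopeCertB 3 eL0 eW0 = true := by decide +kernel

/-- LOOP-E: `eL1` is in coordinate scope (`LoopC.scopeCertB`). [OURS · ‖ K] -/
theorem scope_eL1 : scopeCertB 3 eL1 eW1 = true := by decide +kernel

/-- LOOP-E: `eL2` is in coordinate scope (`LoopC.scopeCertB`). [OURS · ‖ K] -/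
theorem scope_eL2 : scopeCertB 3 eL2 eW2 = true := by decide +kernel

/-- LOOP-E: `eL3` is in coordinate scope (`LoopC.scopeCertB`). [OURS · ‖ K] -/
theorem scope_eL3 : scopeCertB 3 eL3 eW3 = true := by decide +kernel

/-- **LOOP-E, region form (GLOBAL game `Edge`)**: `3`-fold origins, a maximal-dimensional component at every
state, and an `Edge`-successor inside the region for every maximal-dimensional component. [OURS · ‖ K] -/
theorem e_region : ∀ s ∈ trapSet eR, (3 : ℕ∞) ≤ ordAlong Finset.univ s.F ∧
    (∃ S, IsComponent 3 S s.F ∧ ∀ S', IsComponent 3 S' s.F → S.card ≤ S'.card) ∧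
    ∀ S, IsComponent 3 S s.F → (∀ S', IsComponent 3 S' s.F → S.card ≤ S'.card) →
      ∃ s' ∈ trapSet eR, Edge 3 S s s' :=
  region_of_regionB regionB_e

/-- **LOOP-E, scope form**: every region state is in coordinate scope. [OURS · ‖ K] -/
theorem e_inScope : ∀ s ∈ trapSet eR, InCoordinateScope 3 s.F := by
  rintro s ⟨sw, hsw, rfl⟩
  simp only [eR, List.mem_cons, List.not_mem_nil, or_false] at hsw
  rcases hsw with rfl | rfl | rfl | rfl | rfl
  · exact inCoordinateScope_of_scopeCertB scope_eL0
  · exact inCoordinateScope_of_scopeCertB scope_eL1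
  · exact inCoordinateScope_of_scopeCertB scope_eL2
  · exact inCoordinateScope_of_scopeCertB scope_eL3
  · exact inCoordinateScope_of_scopeCertB scope_eL0

/-- LOOP-E: the first row (with `r = 0`, `exc = ∅`) presents a member of the region. [OURS] -/
theorem e0_mem : e0.toState ∈ trapSet eR :=
  ⟨(e0, [({0, 3}, 0, ![0, 0, 0, 0], 1)]), by simp [eR], rfl⟩

/-- LOOP-E: at every region state the coordinate `3`-fold locus has EXACTLY ONE component. [OURS · ‖ K] -/
theorem e_lone : ∀ s ∈ trapSet eR, ∀ S S', IsComponent 3 S s.F → IsComponent 3 S' s.F → S' = S := by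
  have key : ∀ (L : Terms 4 (ZMod 3)), decide (∀ S S' : Finset (Fin 4),
      componentB 3 S L = true → componentB 3 S' L = true → S' = S) = true →
      ∀ (r : Fin 4 → ℕ) (exc : Finset (Fin 4)) (S S' : Finset (Fin 4)),
      IsComponent 3 S (SData.toState ⟨L, r, exc⟩).F → IsComponent 3 S' (SData.toState ⟨L, r, exc⟩).F → S' = S := by
    intro L h r exc S S' hS hS'
    rw [decide_eq_true_eq] at h
    exact h S S' ((isComponent_iff 3 S L).mp hS) ((isComponent_iff 3 S' L).mp hS')
  rintro s ⟨sw, hsw, rfl⟩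
  simp only [eR, List.mem_cons, List.not_mem_nil, or_false] at hsw
  rcases hsw with rfl | rfl | rfl | rfl | rfl
  · exact key eL0 (by decide +kernel) _ _
  · exact key eL1 (by decide +kernel) _ _
  · exact key eL2 (by decide +kernel) _ _
  · exact key eL3 (by decide +kernel) _ _
  · exact key eL0 (by decide +kernel) _ _

/-- **LOOP-E kills the LONE-COMPONENT rule class in the GLOBAL game**: over `𝔽₃` at `(3,3)`, every coordinate
rule that blows up THE component whenever the coordinate `3`-fold locus has exactly one (`R_X`, `R_XT`, `R_OD`,
cardinality-first, … — any rule keyed to the component structure) has an infinite branch of in-scope states inside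
the region. [OURS · ‖ K] -/
theorem exists_inScope_branch_of_loneComponentRule (R : CentreRule (ZMod 3))
    (hR : ∀ (s : State (ZMod 3)) (S : Finset (Fin 4)), IsComponent 3 S s.F →
      (∀ S', IsComponent 3 S' s.F → S' = S) → R s = S) :
    ∃ c : ℕ → State (ZMod 3), (∀ k, c k ∈ trapSet eR) ∧
      ∀ k, InCoordinateScope 3 (c k).F ∧ StepRule 3 R (c k) (c (k + 1)) := by
  have key : ∀ s : trapSet eR, ∃ s' : trapSet eR, StepRule 3 R (s : State (ZMod 3)) (s' : State (ZMod 3)) := by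
    rintro ⟨s, hs⟩
    obtain ⟨-, ⟨S₀, hS₀, hmin⟩, hall⟩ := e_region s hs
    have hRS : R s = S₀ := hR s S₀ hS₀ (fun S' hS' => e_lone s hs S₀ S' hS₀ hS')
    obtain ⟨s', hs', hedge⟩ := hall S₀ hS₀ hmin
    exact ⟨⟨s', hs'⟩, hRS ▸ hS₀.1, hRS ▸ hedge⟩
  choose f hf using key
  refine ⟨fun k => ((f^[k] ⟨e0.toState, e0_mem⟩ : trapSet eR) : State (ZMod 3)),
    fun k => (f^[k] ⟨e0.toState, e0_mem⟩).2, fun k => ⟨e_inScope _ (f^[k] _).2, ?_⟩⟩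
  show StepRule 3 R ((f^[k] _ : trapSet eR) : State (ZMod 3)) ((f^[k + 1] _ : trapSet eR) : State (ZMod 3))
  rw [Function.iterate_succ_apply']
  exact hf _

/-! ## §3 LOOP-E′ (three variables) data -/

/-- LOOP-E′: polynomial `gL0` (`t1′`). [OURS · specimen] -/
def gL0 : Terms 4 (ZMod 3) := [(![2, 0, 0, 2], 1), (![2, 0, 1, 2], 1), (![2, 0, 0, 4], 1), (![2, 0, 1, 4], 2), (![2, 0, 3, 2], 1), (![2, 0, 2, 4], 1), (![2, 0, 4, 2], 1)]

/-- LOOP-E′: polynomial `gL1` (`t2′`). [OURS · specimen] -/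
def gL1 : Terms 4 (ZMod 3) := [(![1, 0, 0, 2], 1), (![1, 0, 1, 2], 1), (![1, 0, 3, 2], 1), (![1, 0, 4, 2], 1), (![3, 0, 0, 4], 1), (![3, 0, 1, 4], 2), (![3, 0, 2, 4], 1)]

/-- LOOP-E′: polynomial `gL2` (`t3′`). [OURS · specimen] -/
def gL2 : Terms 4 (ZMod 3) := [(![0, 0, 4, 0], 1), (![0, 0, 4, 1], 2), (![0, 0, 4, 2], 1), (![4, 0, 2, 0], 1), (![4, 0, 2, 1], 1), (![4, 0, 2, 3], 1), (![4, 0, 2, 4], 1)]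

/-- LOOP-E′: polynomial `gL3` (`t4′`). [OURS · specimen] -/
def gL3 : Terms 4 (ZMod 3) := [(![1, 0, 4, 0], 1), (![3, 0, 2, 0], 1), (![1, 0, 4, 1], 2), (![3, 0, 2, 1], 1), (![1, 0, 4, 2], 1), (![3, 0, 2, 3], 1), (![3, 0, 2, 4], 1)]

/-- LOOP-E′: region state `g0` = (`gL0`, `r = [0, 0, 0, 0]`, `exc = ∅`). [OURS · specimen] -/
def g0 : SData 4 (ZMod 3) := ⟨gL0, ![0, 0, 0, 0], ∅⟩

/-- LOOP-E′: region state `g1` = (`gL1`, `r = [1, 0, 0, 0]`, `exc = {0}`). [OURS · specimen] -/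
def g1 : SData 4 (ZMod 3) := ⟨gL1, ![1, 0, 0, 0], {0}⟩

/-- LOOP-E′: region state `g2` = (`gL2`, `r = [0, 0, 0, 0]`, `exc = {0}`). [OURS · specimen] -/
def g2 : SData 4 (ZMod 3) := ⟨gL2, ![0, 0, 0, 0], {0}⟩

/-- LOOP-E′: region state `g3` = (`gL3`, `r = [1, 0, 0, 0]`, `exc = {0}`). [OURS · specimen] -/
def g3 : SData 4 (ZMod 3) := ⟨gL3, ![1, 0, 0, 0], {0}⟩

/-- LOOP-E′: region state `g4` = (`gL0`, `r = [2, 0, 0, 0]`, `exc = {0}`). [OURS · specimen] -/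
def g4 : SData 4 (ZMod 3) := ⟨gL0, ![2, 0, 0, 0], {0}⟩

/-- LOOP-E′ region table: crit-1's x₂-FREE variant `t1′ = x₁²x₄²u²(u² + x₄²)` under the identical hop pattern — a period-4 lone-plane cycle in the THREE variables x₁, x₃, x₄ (eng-w4 g2 j316916 `t1′-cyc-0…3`); rows = (state, B's reply `(centre, chart, point, child row)` to the LONE
maximal-dimensional component). [OURS · specimen] -/
def gR : TrapRows (ZMod 3) :=
  [(g0, [({0, 3}, 0, ![0, 0, 0, 0], 1)]),
   (g1, [({0, 3}, 0, ![0, 0, 2, 1], 2)]),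
   (g2, [({0, 2}, 0, ![0, 0, 0, 0], 3)]),
   (g3, [({0, 2}, 0, ![0, 0, 1, 2], 4)]),
   (g4, [({0, 3}, 0, ![0, 0, 0, 0], 1)])]

/-- LOOP-E′: in-scope witnesses `(α, m)` for `gL0`. [OURS · certificate data] -/
def gW0 : List ((Fin 4 → ℕ) × (Fin 4 → ℕ)) := [(![0, 0, 0, 2], ![2, 0, 0, 0]), (![2, 0, 0, 0], ![0, 0, 0, 2])]

/-- LOOP-E′: in-scope witnesses `(α, m)` for `gL1`. [OURS · certificate data] -/
def gW1 : List ((Fin 4 → ℕ) × (Fin 4 → ℕ)) := [(![0, 0, 0, 2], ![1, 0, 0, 0]), (![1, 0, 0, 0], ![0, 0, 0, 2])]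

/-- LOOP-E′: in-scope witnesses `(α, m)` for `gL2`. [OURS · certificate data] -/
def gW2 : List ((Fin 4 → ℕ) × (Fin 4 → ℕ)) := [(![0, 0, 0, 2], ![0, 0, 4, 0]), (![0, 0, 2, 0], ![4, 0, 0, 0])]

/-- LOOP-E′: in-scope witnesses `(α, m)` for `gL3`. [OURS · certificate data] -/
def gW3 : List ((Fin 4 → ℕ) × (Fin 4 → ℕ)) := [(![0, 0, 2, 0], ![3, 0, 0, 0]), (![1, 0, 0, 0], ![0, 0, 4, 0])]

/-! ## §4 LOOP-E′: kernel checks and conclusions -/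

/-- LOOP-E′: the region table checks (`LoopC.regionB`). [OURS · ‖ K] -/
theorem regionB_g : regionB 3 gR = true := by decide +kernel

/-- LOOP-E′: `gL0` is in coordinate scope (`LoopC.scopeCertB`). [OURS · ‖ K] -/
theorem scope_gL0 : scopeCertB 3 gL0 gW0 = true := by decide +kernel

/-- LOOP-E′: `gL1` is in coordinate scope (`LoopC.scopeCertB`). [OURS · ‖ K] -/
theorem scope_gL1 : scopeCertB 3 gL1 gW1 = true := by decide +kernel

/-- LOOP-E′: `gL2` is in coordinate scope (`LoopC.scopeCertB`). [OURS · ‖ K] -/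
theorem scope_gL2 : scopeCertB 3 gL2 gW2 = true := by decide +kernel

/-- LOOP-E′: `gL3` is in coordinate scope (`LoopC.scopeCertB`). [OURS · ‖ K] -/
theorem scope_gL3 : scopeCertB 3 gL3 gW3 = true := by decide +kernel

/-- **LOOP-E′, region form (GLOBAL game `Edge`)**: `3`-fold origins, a maximal-dimensional component at every
state, and an `Edge`-successor inside the region for every maximal-dimensional component. [OURS · ‖ K] -/
theorem g_region : ∀ s ∈ trapSet gR, (3 : ℕ∞) ≤ ordAlong Finset.univ s.F ∧
    (∃ S, IsComponent 3 S s.F ∧ ∀ S', IsComponent 3 S' s.F → S.card ≤ S'.card) ∧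
    ∀ S, IsComponent 3 S s.F → (∀ S', IsComponent 3 S' s.F → S.card ≤ S'.card) →
      ∃ s' ∈ trapSet gR, Edge 3 S s s' :=
  region_of_regionB regionB_g

/-- **LOOP-E′, scope form**: every region state is in coordinate scope. [OURS · ‖ K] -/
theorem g_inScope : ∀ s ∈ trapSet gR, InCoordinateScope 3 s.F := by
  rintro s ⟨sw, hsw, rfl⟩
  simp only [gR, List.mem_cons, List.not_mem_nil, or_false] at hsw
  rcases hsw with rfl | rfl | rfl | rfl | rfl
  · exact inCoordinateScope_of_scopeCertB scope_gL0
  · exact inCoordinateScope_of_scopeCertB scope_gL1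
  · exact inCoordinateScope_of_scopeCertB scope_gL2
  · exact inCoordinateScope_of_scopeCertB scope_gL3
  · exact inCoordinateScope_of_scopeCertB scope_gL0

/-- LOOP-E′: the first row (with `r = 0`, `exc = ∅`) presents a member of the region. [OURS] -/
theorem g0_mem : g0.toState ∈ trapSet gR :=
  ⟨(g0, [({0, 3}, 0, ![0, 0, 0, 0], 1)]), by simp [gR], rfl⟩

/-- LOOP-E′: at every region state the coordinate `3`-fold locus has EXACTLY ONE component. [OURS · ‖ K] -/
theorem g_lone : ∀ s ∈ trapSet gR, ∀ S S', IsComponent 3 S s.F → IsComponent 3 S' s.F → S' = S := by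
  have key : ∀ (L : Terms 4 (ZMod 3)), decide (∀ S S' : Finset (Fin 4),
      componentB 3 S L = true → componentB 3 S' L = true → S' = S) = true →
      ∀ (r : Fin 4 → ℕ) (exc : Finset (Fin 4)) (S S' : Finset (Fin 4)),
      IsComponent 3 S (SData.toState ⟨L, r, exc⟩).F → IsComponent 3 S' (SData.toState ⟨L, r, exc⟩).F → S' = S := by
    intro L h r exc S S' hS hS'
    rw [decide_eq_true_eq] at h
    exact h S S' ((isComponent_iff 3 S L).mp hS) ((isComponent_iff 3 S' L).mp hS')
  rintro s ⟨sw, hsw, rfl⟩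
  simp only [gR, List.mem_cons, List.not_mem_nil, or_false] at hsw
  rcases hsw with rfl | rfl | rfl | rfl | rfl
  · exact key gL0 (by decide +kernel) _ _
  · exact key gL1 (by decide +kernel) _ _
  · exact key gL2 (by decide +kernel) _ _
  · exact key gL3 (by decide +kernel) _ _
  · exact key gL0 (by decide +kernel) _ _

/-- **LOOP-E′ kills the LONE-COMPONENT rule class in the GLOBAL game**: over `𝔽₃` at `(3,3)`, every coordinate
rule that blows up THE component whenever the coordinate `3`-fold locus has exactly one (`R_X`, `R_XT`, `R_OD`,
cardinality-first, … — any rule keyed to the component structure) has an infinite branch of in-scope states inside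
the region. [OURS · ‖ K] -/
theorem exists_inScope_branch_of_loneComponentRule' (R : CentreRule (ZMod 3))
    (hR : ∀ (s : State (ZMod 3)) (S : Finset (Fin 4)), IsComponent 3 S s.F →
      (∀ S', IsComponent 3 S' s.F → S' = S) → R s = S) :
    ∃ c : ℕ → State (ZMod 3), (∀ k, c k ∈ trapSet gR) ∧
      ∀ k, InCoordinateScope 3 (c k).F ∧ StepRule 3 R (c k) (c (k + 1)) := by
  have key : ∀ s : trapSet gR, ∃ s' : trapSet gR, StepRule 3 R (s : State (ZMod 3)) (s' : State (ZMod 3)) := by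
    rintro ⟨s, hs⟩
    obtain ⟨-, ⟨S₀, hS₀, hmin⟩, hall⟩ := g_region s hs
    have hRS : R s = S₀ := hR s S₀ hS₀ (fun S' hS' => g_lone s hs S₀ S' hS₀ hS')
    obtain ⟨s', hs', hedge⟩ := hall S₀ hS₀ hmin
    exact ⟨⟨s', hs'⟩, hRS ▸ hS₀.1, hRS ▸ hedge⟩
  choose f hf using key
  refine ⟨fun k => ((f^[k] ⟨g0.toState, g0_mem⟩ : trapSet gR) : State (ZMod 3)),
    fun k => (f^[k] ⟨g0.toState, g0_mem⟩).2, fun k => ⟨g_inScope _ (f^[k] _).2, ?_⟩⟩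
  show StepRule 3 R ((f^[k] _ : trapSet gR) : State (ZMod 3)) ((f^[k + 1] _ : trapSet gR) : State (ZMod 3))
  rw [Function.iterate_succ_apply']
  exact hf _

end LoopC

end Summit.ResolutionOfSingularities.ResolutionOfSingularities.Theorems.PIDim4

end
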